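import Mathlib
import Summits.KontsevichZagierPeriods.KontsevichZagierPeriods.Theorems.SoloInformedAyoubSymbols
import Summits.KontsevichZagierPeriods.KontsevichZagierPeriods.Theorems.SoloInformedKZCubeGrid
import HarnessLib

/-!
# SoloInformed — algebraic functions analytic near the cube are Ayoub-presentable

THEOREM P_A (`SoloInformedAyoubPresentation`) asks for a presentation of every integral
representation, modulo the KZ moves, by cube integrals of real parts of *Ayoub generators*: power
series algebraic over `ℚ(z)` whose radius of convergence exceeds `1`. This file removes the radius
condition from the crux: if `r = [[0,1]ⁿ, Re g ∘ ι]` with `g` complex-analytic on an open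
`U ⊇ ι([0,1]ⁿ)`, real on the real points of `U` and algebraic over `ℚ(z)` on `U`, then

  `[r] − ∑ⱼ [[0,1]ⁿ, Re aⱼ ∘ ι] ∈ KZ.relations`

for `Nⁿ` genuine Ayoub generators `aⱼ` of radius `2`
(`soloInformed_cubePresentation_of_analytic`). Mechanism: a Lebesgue-number argument gives `N`
with `(j + 𝔻ⁿ(0,2))/N ⊆ U` for every multi-index `j`; the grid subdivision theorem
`soloInformed_grid_mem_relations` (rules (1)–(2) of the KZ calculus) rewrites `[r]` as the sum of
the rescaled pieces `x ↦ N⁻ⁿ g((j + x)/N)`, and each rescaled piece *is* an Ayoub generator: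
analytic on the polydisc of radius `2`, real on real points, and algebraic with the explicitly
substituted polynomial `P((j + z)/N, Nⁿ T)`.

Consequently the open part of THEOREM P_A is only a *resolution* statement (every integral
representation is KZ-equivalent to a combination of cube integrals of functions algebraic and
analytic near the closed cube — no control of any radius of convergence is needed); see
`SoloInformedAyoubCubeResolution` (file `SoloInformedCubeResolution`).

References: J. Ayoub, EMS Newsl. 91 (2014), Def. 9–10; Kontsevich–Zagier 2001, §1.2.
-/

noncomputable section

open scoped BigOperators
open MeasureTheory Set
open Literature.NumberTheory.Transcendental Literature.NumberTheory.Transcendental.KZ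
open Literature.ModelTheory.ExponentialFields (IsSemialgebraic)

namespace Summit.KontsevichZagierPeriods.KontsevichZagierPeriods.Theorems

/-! ### Rational multiples of semialgebraic functions -/

/-- A non-zero rational multiple of a `ℚ`-semialgebraic function is `ℚ`-semialgebraic (its graph
is the preimage of the graph under the polynomial map `(x, y) ↦ (x, y/c)`). [BCR 1998, §2.2] -/
theorem soloInformed_isSemialgebraicFunOn_const_mul {m : ℕ} {s : Set (Fin m → ℝ)}
    {f : (Fin m → ℝ) → ℝ} (hf : IsSemialgebraicFunOn ℚ s f) {c : ℚ} (hc : c ≠ 0) :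
    IsSemialgebraicFunOn ℚ s (fun x => (c : ℝ) * f x) := by
  rw [isSemialgebraicFunOn_iff] at hf ⊢
  have hcr : (c : ℝ) ≠ 0 := by exact_mod_cast hc
  let Q : Fin (m + 1) → MvPolynomial (Fin (m + 1)) ℚ :=
    Fin.snoc (fun i => MvPolynomial.X (Fin.castSucc i))
      (MvPolynomial.C c⁻¹ * MvPolynomial.X (Fin.last m))
  convert hf.preimage_aeval Q using 1
  ext z
  have hinit : Fin.init (fun j => MvPolynomial.aeval z (Q j)) = Fin.init z := by
    funext i
    simp [Fin.init, Q]
  have hlast : MvPolynomial.aeval z (Q (Fin.last m)) = (c : ℝ)⁻¹ * z (Fin.last m) := by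
    simp only [Q, Fin.snoc_last, map_mul, MvPolynomial.aeval_C, MvPolynomial.aeval_X, eq_ratCast]
    push_cast
    ring
  simp only [mem_setOf_eq, mem_preimage, hinit, hlast]
  refine and_congr_right fun _ => ⟨fun h => ?_, fun h => ?_⟩
  · rw [h]
    field_simp
  · rw [← mul_right_inj' hcr, ← h]
    field_simp

/-! ### The complex grid maps -/

/-- The complex grid map `w ↦ (j + w)/N` on `ℂⁿ`. -/
def soloInformedGridMapC {n : ℕ} (N : ℕ) (j : Fin n → Fin N) (w : Fin n → ℂ) : Fin n → ℂ :=
  fun l => (((j l : ℕ) : ℂ) + w l) / N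

/-- Coordinates of the complex grid map. -/
@[simp] theorem soloInformedGridMapC_apply {n : ℕ} (N : ℕ) (j : Fin n → Fin N)
    (w : Fin n → ℂ) (l : Fin n) : soloInformedGridMapC N j w l = (((j l : ℕ) : ℂ) + w l) / N := rfl

/-- The complex grid map extends the real one. -/
theorem soloInformedToC_gridMap {n : ℕ} (N : ℕ) (j : Fin n → Fin N) (x : Fin n → ℝ) :
    soloInformedToC n (soloInformedGridMap N j x) =
      soloInformedGridMapC N j (soloInformedToC n x) := by
  ext l
  simp only [soloInformedToC_apply, soloInformedGridMap_apply, soloInformedGridMapC_apply]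
  push_cast
  rfl

/-- The complex grid map is affine: `w ↦ N⁻¹ • w + j/N`. -/
theorem soloInformedGridMapC_eq {n : ℕ} (N : ℕ) (j : Fin n → Fin N) :
    soloInformedGridMapC N j = fun w => (N : ℂ)⁻¹ • w + fun l => ((j l : ℕ) : ℂ) / N := by
  funext w
  ext l
  simp only [soloInformedGridMapC_apply, Pi.add_apply, Pi.smul_apply, smul_eq_mul]
  ring

/-- The complex grid map is analytic. -/
theorem soloInformed_analyticAt_gridMapC {n : ℕ} (N : ℕ) (j : Fin n → Fin N)
    (w : Fin n → ℂ) : AnalyticAt ℂ (soloInformedGridMapC N j) w := by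
  rw [soloInformedGridMapC_eq]
  exact ((analyticAt_const : AnalyticAt ℂ (fun _ : Fin n → ℂ => (N : ℂ)⁻¹) w).smul
    analyticAt_id).add analyticAt_const

/-- Distance from the complex grid map to the corner `j/N` of its cell. -/
theorem soloInformedGridMapC_sub_corner {n : ℕ} (N : ℕ) (j : Fin n → Fin N)
    (w : Fin n → ℂ) :
    soloInformedGridMapC N j w - soloInformedToC n (fun l => ((j l : ℕ) : ℝ) / N) =
      (N : ℂ)⁻¹ • w := by
  ext l
  simp only [Pi.sub_apply, soloInformedGridMapC_apply, soloInformedToC_apply, Pi.smul_apply,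
    smul_eq_mul]
  push_cast
  ring

/-- The corner `j/N` lies in the cube. -/
theorem soloInformed_corner_mem_cube {n N : ℕ} (j : Fin n → Fin N) :
    (fun l => ((j l : ℕ) : ℝ) / N) ∈ soloInformedCube n := by
  rw [soloInformed_mem_cube_iff]
  intro l
  have hN : (0 : ℝ) < N := by
    have := (j l).pos
    exact_mod_cast this
  refine ⟨div_nonneg (by positivity) hN.le, (div_le_one hN).2 ?_⟩
  exact_mod_cast (j l).isLt.le

/-- **Lebesgue number of the grid.** If `U` is an open neighbourhood of `ι([0,1]ⁿ)` in `ℂⁿ`,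
then for some `N ≥ 1` every complex grid map `w ↦ (j + w)/N` sends the polydisc `𝔻ⁿ(0, 2)`
into `U`. -/
theorem soloInformed_exists_grid_mapsTo {n : ℕ} {U : Set (Fin n → ℂ)} (hUo : IsOpen U)
    (hU : MapsTo (soloInformedToC n) (soloInformedCube n) U) :
    ∃ N : ℕ, 0 < N ∧ ∀ j : Fin n → Fin N,
      MapsTo (soloInformedGridMapC N j) (Metric.ball 0 2) U := by
  have hK : IsCompact (soloInformedToC n '' soloInformedCube n) :=
    (isCompact_soloInformedCube n).image (soloInformedToC n).continuous
  obtain ⟨δ, hδ, hδU⟩ := hK.exists_thickening_subset_open hUo (image_subset_iff.2 hU)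
  obtain ⟨N, hN⟩ := exists_nat_gt (2 / δ)
  have hNr : (0 : ℝ) < N := lt_trans (by positivity) hN
  have hNpos : 0 < N := by exact_mod_cast hNr
  refine ⟨N, hNpos, fun j w hw => hδU ?_⟩
  rw [Metric.mem_thickening_iff]
  refine ⟨soloInformedToC n (fun l => ((j l : ℕ) : ℝ) / N),
    mem_image_of_mem _ (soloInformed_corner_mem_cube j), ?_⟩
  rw [dist_eq_norm, soloInformedGridMapC_sub_corner, norm_smul, norm_inv,
    Complex.norm_natCast]
  rw [Metric.mem_ball, dist_zero_right] at hw
  calc (N : ℝ)⁻¹ * ‖w‖ ≤ (N : ℝ)⁻¹ * 2 := by gcongr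
    _ = 2 / N := by rw [inv_mul_eq_div]
    _ < δ := by
      rw [div_lt_iff₀ hNr]
      rw [div_lt_iff₀ hδ] at hN
      linarith

/-! ### The substituted polynomial -/

/-- The substitution `zₗ ↦ (jₗ + zₗ)/N`, `T ↦ Nⁿ T`. -/
def soloInformedGridSubst {n : ℕ} (N : ℕ) (j : Fin n → Fin N) :
    Fin (n + 1) → MvPolynomial (Fin (n + 1)) ℚ :=
  Fin.snoc (fun l => MvPolynomial.C (((j l : ℕ) : ℚ) / N) +
      MvPolynomial.C ((1 : ℚ) / N) * MvPolynomial.X (Fin.castSucc l))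
    (MvPolynomial.C ((N : ℚ) ^ n) * MvPolynomial.X (Fin.last n))

/-- The inverse substitution `zₗ ↦ N zₗ − jₗ`, `T ↦ N⁻ⁿ T`. -/
def soloInformedGridSubstInv {n : ℕ} (N : ℕ) (j : Fin n → Fin N) :
    Fin (n + 1) → MvPolynomial (Fin (n + 1)) ℚ :=
  Fin.snoc (fun l => MvPolynomial.C (-(((j l : ℕ) : ℚ))) +
      MvPolynomial.C (N : ℚ) * MvPolynomial.X (Fin.castSucc l))
    (MvPolynomial.C (((N : ℚ) ^ n)⁻¹) * MvPolynomial.X (Fin.last n))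

/-- The inverse substitution undoes the substitution on every variable. -/
theorem soloInformed_bind₁_gridSubst {n N : ℕ} (hN : 0 < N) (j : Fin n → Fin N)
    (k : Fin (n + 1)) :
    MvPolynomial.bind₁ (soloInformedGridSubstInv N j) (soloInformedGridSubst N j k) =
      MvPolynomial.X k := by
  have hNq : (N : ℚ) ≠ 0 := by exact_mod_cast hN.ne'
  induction k using Fin.lastCases with
  | last =>
    simp only [soloInformedGridSubst, soloInformedGridSubstInv, Fin.snoc_last, map_mul,
      MvPolynomial.bind₁_C_right, MvPolynomial.bind₁_X_right]
    rw [← mul_assoc, ← MvPolynomial.C_mul, mul_inv_cancel₀ (pow_ne_zero _ hNq),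
      MvPolynomial.C_1, one_mul]
  | cast l =>
    simp only [soloInformedGridSubst, soloInformedGridSubstInv, Fin.snoc_castSucc, map_add,
      map_mul, MvPolynomial.bind₁_C_right, MvPolynomial.bind₁_X_right]
    rw [mul_add, ← mul_assoc, ← MvPolynomial.C_mul, ← MvPolynomial.C_mul, ← add_assoc,
      ← MvPolynomial.C_add, show ((j l : ℕ) : ℚ) / N + 1 / N * -((j l : ℕ) : ℚ) = 0 by
        field_simp; ring, show (1 : ℚ) / N * N = 1 by field_simp, MvPolynomial.C_0, zero_add,
      MvPolynomial.C_1, one_mul]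

/-- The substitution is injective on polynomials: `P ≠ 0 → P((j+z)/N, Nⁿ T) ≠ 0`. -/
theorem soloInformed_bind₁_gridSubst_ne_zero {n N : ℕ} (hN : 0 < N) (j : Fin n → Fin N)
    {P : MvPolynomial (Fin (n + 1)) ℚ} (hP : P ≠ 0) :
    MvPolynomial.bind₁ (soloInformedGridSubst N j) P ≠ 0 := by
  intro h
  apply hP
  have h2 := congr_arg (MvPolynomial.bind₁ (soloInformedGridSubstInv N j)) h
  rw [map_zero, MvPolynomial.bind₁_bind₁, show (fun k => MvPolynomial.bind₁
      (soloInformedGridSubstInv N j) (soloInformedGridSubst N j k)) = MvPolynomial.X from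
      funext (soloInformed_bind₁_gridSubst hN j)] at h2
  simpa [MvPolynomial.bind₁_X_left] using h2

/-- Evaluating the substituted polynomial: `P((j+w)/N, Nⁿ t)` at `(w, t)`. -/
theorem soloInformed_aeval_bind₁_gridSubst {n N : ℕ} (j : Fin n → Fin N)
    (P : MvPolynomial (Fin (n + 1)) ℚ) (w : Fin n → ℂ) (t : ℂ) :
    MvPolynomial.aeval (Fin.snoc w t) (MvPolynomial.bind₁ (soloInformedGridSubst N j) P) =
      MvPolynomial.aeval (Fin.snoc (soloInformedGridMapC N j w) ((N : ℂ) ^ n * t)) P := by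
  have hv : (fun k => MvPolynomial.aeval (Fin.snoc w t : Fin (n + 1) → ℂ)
      (soloInformedGridSubst N j k)) =
      Fin.snoc (soloInformedGridMapC N j w) ((N : ℂ) ^ n * t) := by
    funext k
    induction k using Fin.lastCases with
    | last =>
      simp only [soloInformedGridSubst, Fin.snoc_last, map_mul, MvPolynomial.aeval_C,
        MvPolynomial.aeval_X, eq_ratCast]
      push_cast
      ring
    | cast l =>
      simp only [soloInformedGridSubst, Fin.snoc_castSucc, map_add, map_mul,
        MvPolynomial.aeval_C, MvPolynomial.aeval_X, eq_ratCast, soloInformedGridMapC_apply]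
      push_cast
      ring
  rw [MvPolynomial.aeval_bind₁, hv]

/-! ### The rescaled generators -/

/-- **The rescaled piece is an Ayoub generator.** For `g` analytic on `U`, real on real points
and algebraic (`P(z, g z) = 0` on `U`, `P ≠ 0`), and a grid map with `(j + 𝔻ⁿ(0,2))/N ⊆ U`, the
function `w ↦ N⁻ⁿ g((j + w)/N)` is an Ayoub generator of radius `2`. [Ayoub 2014, Def. 9] -/
def soloInformedGridGen {n : ℕ} {U : Set (Fin n → ℂ)} {g : (Fin n → ℂ) → ℂ}
    (hg : AnalyticOnNhd ℂ g U)
    (hreal : ∀ x : Fin n → ℝ, soloInformedToC n x ∈ U → (g (soloInformedToC n x)).im = 0)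
    {P : MvPolynomial (Fin (n + 1)) ℚ} (hP : P ≠ 0)
    (hPg : ∀ z ∈ U, MvPolynomial.aeval (Fin.snoc z (g z)) P = 0)
    {N : ℕ} (hN : 0 < N) (j : Fin n → Fin N)
    (hj : MapsTo (soloInformedGridMapC N j) (Metric.ball 0 2) U) : SoloInformedAyoubGen n where
  f w := ((N : ℂ) ^ n)⁻¹ * g (soloInformedGridMapC N j w)
  ρ := 2
  one_lt := one_lt_two
  analytic w hw :=
    analyticAt_const.mul ((hg _ (hj hw)).comp (soloInformed_analyticAt_gridMapC N j w))
  real x hx := by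
    have hx' : soloInformedToC n (soloInformedGridMap N j x) ∈ U := by
      rw [soloInformedToC_gridMap]
      exact hj hx
    have h := hreal _ hx'
    rw [soloInformedToC_gridMap] at h
    rw [show ((N : ℂ) ^ n)⁻¹ = ((((N : ℝ) ^ n)⁻¹ : ℝ) : ℂ) by push_cast; rfl,
      Complex.im_ofReal_mul, h, mul_zero]
  algebraic := by
    refine ⟨MvPolynomial.bind₁ (soloInformedGridSubst N j) P,
      soloInformed_bind₁_gridSubst_ne_zero hN j hP, fun w hw => ?_⟩
    have hNc : (N : ℂ) ≠ 0 := by exact_mod_cast hN.ne'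
    rw [soloInformed_aeval_bind₁_gridSubst, ← mul_assoc,
      mul_inv_cancel₀ (pow_ne_zero _ hNc), one_mul]
    exact hPg _ (hj hw)

/-- The function of the rescaled generator. -/
@[simp] theorem soloInformedGridGen_f {n : ℕ} {U : Set (Fin n → ℂ)} {g : (Fin n → ℂ) → ℂ}
    (hg : AnalyticOnNhd ℂ g U)
    (hreal : ∀ x : Fin n → ℝ, soloInformedToC n x ∈ U → (g (soloInformedToC n x)).im = 0)
    {P : MvPolynomial (Fin (n + 1)) ℚ} (hP : P ≠ 0)
    (hPg : ∀ z ∈ U, MvPolynomial.aeval (Fin.snoc z (g z)) P = 0)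
    {N : ℕ} (hN : 0 < N) (j : Fin n → Fin N)
    (hj : MapsTo (soloInformedGridMapC N j) (Metric.ball 0 2) U) (w : Fin n → ℂ) :
    (soloInformedGridGen hg hreal hP hPg hN j hj).f w =
      ((N : ℂ) ^ n)⁻¹ * g (soloInformedGridMapC N j w) := rfl

/-- Real part of the rescaled generator at a real point. -/
theorem soloInformedGridGen_re {n : ℕ} {U : Set (Fin n → ℂ)} {g : (Fin n → ℂ) → ℂ}
    (hg : AnalyticOnNhd ℂ g U)
    (hreal : ∀ x : Fin n → ℝ, soloInformedToC n x ∈ U → (g (soloInformedToC n x)).im = 0)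
    {P : MvPolynomial (Fin (n + 1)) ℚ} (hP : P ≠ 0)
    (hPg : ∀ z ∈ U, MvPolynomial.aeval (Fin.snoc z (g z)) P = 0)
    {N : ℕ} (hN : 0 < N) (j : Fin n → Fin N)
    (hj : MapsTo (soloInformedGridMapC N j) (Metric.ball 0 2) U) (x : Fin n → ℝ) :
    ((soloInformedGridGen hg hreal hP hPg hN j hj).f (soloInformedToC n x)).re =
      ((N : ℝ) ^ n)⁻¹ * (g (soloInformedToC n (soloInformedGridMap N j x))).re := by
  rw [soloInformedGridGen_f, soloInformedToC_gridMap,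
    show ((N : ℂ) ^ n)⁻¹ = ((((N : ℝ) ^ n)⁻¹ : ℝ) : ℂ) by push_cast; rfl, Complex.re_ofReal_mul]

/-! ### The rescaled cube representations -/

/-- The real grid map sends the cube into the cube. -/
theorem soloInformed_gridMap_mapsTo_cube {n N : ℕ} (hN : 0 < N) (j : Fin n → Fin N) :
    MapsTo (soloInformedGridMap N j) (soloInformedCube n) (soloInformedCube n) := fun _ hx =>
  soloInformedGridCell_subset_cube j
    ((soloInformed_image_gridMap_cube hN j).subset (mem_image_of_mem _ hx))

/-- Real points of the cube lie in the polydisc of radius `2`. -/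
theorem soloInformedToC_mem_ball_two {n : ℕ} {x : Fin n → ℝ} (hx : x ∈ soloInformedCube n) :
    soloInformedToC n x ∈ Metric.ball (0 : Fin n → ℂ) 2 := by
  rw [Metric.mem_ball, dist_zero_right]
  refine lt_of_le_of_lt ((pi_norm_le_iff_of_nonneg zero_le_one).2 fun l => ?_) one_lt_two
  rw [soloInformed_mem_cube_iff] at hx
  rw [soloInformedToC_apply, Complex.norm_real, Real.norm_eq_abs, abs_le]
  obtain ⟨h0, h1⟩ := hx l
  constructor <;> linarith

/-- The integrand `x ↦ N⁻ⁿ Re g(ι((j+x)/N))` of the rescaled piece is `ℚ`-semialgebraic and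
continuous on the cube when `Re g ∘ ι` agrees on the cube with the integrand of an integral
representation. [BCR 1998, §2.2] -/
theorem soloInformed_gridPiece_props {n : ℕ} {U : Set (Fin n → ℂ)} {g : (Fin n → ℂ) → ℂ}
    (hg : AnalyticOnNhd ℂ g U) {N : ℕ} (hN : 0 < N) (j : Fin n → Fin N)
    (hj : MapsTo (soloInformedGridMapC N j) (Metric.ball 0 2) U)
    (r : IntegralRep n) (hr : r.domain = soloInformedCube n)
    (hri : EqOn r.integrand (fun x => (g (soloInformedToC n x)).re) (soloInformedCube n)) :
    IsSemialgebraicFunOn ℚ (soloInformedCube n)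
        (fun x => ((N : ℝ) ^ n)⁻¹ * (g (soloInformedToC n (soloInformedGridMap N j x))).re) ∧
      ContinuousOn
        (fun x => ((N : ℝ) ^ n)⁻¹ * (g (soloInformedToC n (soloInformedGridMap N j x))).re)
        (soloInformedCube n) := by
  have hmaps := soloInformed_gridMap_mapsTo_cube hN j
  constructor
  · have h1 : IsSemialgebraicFunOn ℚ (soloInformedCube n) r.integrand :=
      hr ▸ r.isSemialgebraicFunOn_integrand
    have h2 : IsSemialgebraicFunOn ℚ (soloInformedCube n)
        (fun x => (g (soloInformedToC n (soloInformedGridMap N j x))).re) :=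
      (IsSemialgebraicFunOn.comp_isSemialgebraicMapOn_holds h1
        (soloInformed_isSemialgebraicMapOn_gridMap N j) hmaps).congr
        fun x hx => hri (hmaps hx)
    have hq : (((N : ℚ) ^ n)⁻¹ : ℚ) ≠ 0 :=
      inv_ne_zero (pow_ne_zero _ (by exact_mod_cast hN.ne'))
    convert soloInformed_isSemialgebraicFunOn_const_mul h2 hq using 2
    push_cast
    rfl
  · have hU : MapsTo (fun x => soloInformedToC n (soloInformedGridMap N j x))
        (soloInformedCube n) U := fun x hx => by
      show soloInformedToC n (soloInformedGridMap N j x) ∈ U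
      rw [soloInformedToC_gridMap]
      exact hj (soloInformedToC_mem_ball_two hx)
    have hc : Continuous fun x => soloInformedToC n (soloInformedGridMap N j x) := by
      refine (soloInformedToC n).continuous.comp ?_
      rw [soloInformedGridMap_eq]
      fun_prop
    exact continuousOn_const.mul
      (Complex.continuous_re.comp_continuousOn (hg.continuousOn.comp hc.continuousOn hU))

/-- The rescaled cube representation `[[0,1]ⁿ, x ↦ N⁻ⁿ Re g(ι((j+x)/N))]`. -/
def soloInformedGridPiece {n : ℕ} {U : Set (Fin n → ℂ)} {g : (Fin n → ℂ) → ℂ}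
    (hg : AnalyticOnNhd ℂ g U) {N : ℕ} (hN : 0 < N) (j : Fin n → Fin N)
    (hj : MapsTo (soloInformedGridMapC N j) (Metric.ball 0 2) U)
    (r : IntegralRep n) (hr : r.domain = soloInformedCube n)
    (hri : EqOn r.integrand (fun x => (g (soloInformedToC n x)).re) (soloInformedCube n)) :
    IntegralRep n :=
  soloInformedCubeRep n
    (fun x => ((N : ℝ) ^ n)⁻¹ * (g (soloInformedToC n (soloInformedGridMap N j x))).re)
    (soloInformed_gridPiece_props hg hN j hj r hr hri).1
    (soloInformed_gridPiece_props hg hN j hj r hr hri).2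

/-! ### The presentation theorem -/

/-- **Cube integrals of algebraic functions analytic near the cube are Ayoub-presentable.** If
`r = [[0,1]ⁿ, Re g ∘ ι]` (as an integrand, on the cube) with `g` analytic on an open
`U ⊇ ι([0,1]ⁿ)`, real on the real points of `U` and satisfying `P(z, g z) = 0` on `U` for a
non-zero `P ∈ ℚ[z, T]`, then `[r] − ∑ᵢ [ρᵢ] ∈ KZ.relations` for finitely many cube representations
`ρᵢ` whose integrands are the real parts of genuine Ayoub generators `aᵢ` (radius `2`).
[Ayoub 2014, Def. 9–10; Kontsevich–Zagier 2001, §1.2 rules (1)–(2)] -/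
theorem soloInformed_cubePresentation_of_analytic {n : ℕ} {U : Set (Fin n → ℂ)}
    (hUo : IsOpen U)
    (hU : MapsTo (soloInformedToC n) (soloInformedCube n) U) {g : (Fin n → ℂ) → ℂ}
    (hg : AnalyticOnNhd ℂ g U)
    (hreal : ∀ x : Fin n → ℝ, soloInformedToC n x ∈ U → (g (soloInformedToC n x)).im = 0)
    {P : MvPolynomial (Fin (n + 1)) ℚ} (hP : P ≠ 0)
    (hPg : ∀ z ∈ U, MvPolynomial.aeval (Fin.snoc z (g z)) P = 0)
    (r : IntegralRep n) (hr : r.domain = soloInformedCube n)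
    (hri : EqOn r.integrand (fun x => (g (soloInformedToC n x)).re) (soloInformedCube n)) :
    ∃ (m : ℕ) (a : Fin m → SoloInformedAyoubGen n) (ρ : Fin m → IntegralRep n),
      (∀ i, (ρ i).domain = soloInformedCube n) ∧
      (∀ i, EqOn (ρ i).integrand (fun x => ((a i).f (soloInformedToC n x)).re)
        (soloInformedCube n)) ∧
      of r - ∑ i, of (ρ i) ∈ relations := by
  obtain ⟨N, hN, hj⟩ := soloInformed_exists_grid_mapsTo hUo hU
  let e : (Fin n → Fin N) ≃ Fin (N ^ n) := finFunctionFinEquiv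
  let a : (Fin n → Fin N) → SoloInformedAyoubGen n := fun j =>
    soloInformedGridGen hg hreal hP hPg hN j (hj j)
  let rs : (Fin n → Fin N) → IntegralRep n := fun j =>
    soloInformedGridPiece hg hN j (hj j) r hr hri
  refine ⟨N ^ n, fun i => a (e.symm i), fun i => rs (e.symm i), fun _ => rfl,
    fun i x _ => ?_, ?_⟩
  · exact (soloInformedGridGen_re hg hreal hP hPg hN (e.symm i) (hj _) x).symm
  · rw [e.symm.sum_comp (fun j => of (rs j))]
    refine soloInformed_grid_mem_relations hN r hr rs (fun _ => rfl) fun j x hx => ?_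
    show ((N : ℝ) ^ n)⁻¹ * _ = _
    rw [hri (soloInformed_gridMap_mapsTo_cube hN j hx), inv_pow]

end Summit.KontsevichZagierPeriods.KontsevichZagierPeriods.Theorems
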